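import Summits.QuantumFields.YangMills.Theorems.BalabanUVNodesC44IterMhLinearisation
import Literature.MathematicalPhysics.QuantumFieldTheory.Balaban1983to89.B7TransferAnalyticMean
import HarnessLib

/-!
# (ℓa-C) ROAD B, FILE F2′ — THE (44) REMAINDER OF THE LOG-AVERAGED `k`-FOLD CHART BY CAUCHY ESTIMATES ALONG COMPLEX LINES ([B12] p.253–254's transfer principle):
# `‖(1/i)·log(Ū^k_h(e^{X}U₀)·Ū^k(U₀)⋆) − L^k·Q_k(U₀)X‖ ≤ 8B‖X‖²∕ρ²` on traceless `X` with `4‖X‖ ≤ ρ`, GIVEN ℂ-differentiability and a sup bound `B` on the sup-ball of radius `ρ`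

Cell `pub-ymgap` ∕ `ym-nodeO-ideate`, porter lineage `ymgap-nodeO-port-PTB-1` (gen 6), hand «(44) for `iterMh`, GENERIC + Ω-PROFILE» (director-ym g22 №569; SPEC HOME
`ymgap-nodeO-port-PTB-1/HAND-SPEC-C44-iterMh.md` 877df2046bcf01aa, AMENDMENT 2 «the Cauchy route»: F2+F3 of the first plan are replaced by this assembly; the whole analytic content is
F4′ = the k-FREE polydisc radius `ρ` and bound `B`, displayed here as hypotheses).  GENERIC over `Setup.Params P`, `N`, `U₀ : GaugeField P 0 (SU N)` under the (0.4) guard.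
`--kind proof --supports stmt-QuantumFields-27238 --as helper`; count-neutral.  [B7] = [Balaban1985Averaging]; [B11] = [Balaban1985Variational]; [B12]∕[I] = [Balaban1987RG1].

WHAT IS PROVED (0 def, 0 sorry, axioms standard; ns `Summit.QuantumFields.YangMills.Theorems.C44IterMh`).
* `logChart_iterMh_zero` — `G(0) = 0` for `G X := logOver ↑Ū^k(U₀) (iterMh k (expOver U₀ X))` under the guard (`Ū^k_h(↑U₀) = ↑Ū^k(U₀)` unitary, `log 1 = 0`).
* ★ `fderiv_logChart_iterMh_apply` — the FRÉCHET form of F1's line derivative: if `G` is ℂ-differentiable at `0` then `fderiv ℂ G 0 X c = D(Ū^k_h)(↑U₀)[X·U₀](c)·Ū^k(U₀)(c)⋆`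
  (every `X`); ★ `fderiv_logChart_iterMh_apply_of_traceless` — `= L^k • (Q_k(U₀)X)(c)` on traceless `X` (F1 ✓`fderiv_iterMh_mul_star_eq_qCplxOp`).
* ★★★ `norm_logChart_iterMh_sub_qCplxOp_le` — THE (44) REMAINDER: `DifferentiableOn ℂ G (ball 0 ρ)`, `‖G‖ ≤ B` on `ball 0 ρ`, `4‖X‖ ≤ ρ`, `tr X_b = 0` ⇒
  `‖G X − L^k • Q_k(U₀) X‖ ≤ 8·B·‖X‖²∕ρ²` — lit ✓`B7TransferAnalyticMean.norm_sub_sub_fderiv_le_of_line` (Cauchy's inequality for the second Taylor remainder along the complex line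
  `t ↦ tX`, ✓`Literature.Analysis.Complex.CauchyTaylorBall`) + the two items above.  With `B, ρ` k-free (F4′) this is [B11] (44) «`|C(A′)| ≤ C₂|A′|²`» with `C₂ = 8B∕ρ²`, for ANY
  level profile (the (115)-weights only shrink `‖η_k A′‖_∞ ≤ r`), no locality or telescoping needed — [B12] p.253: «The considerations and results … are valid universally for all
  averages» having the analyticity (0.8).

HONEST FRAMING.  An assembly: the k-free `(ρ, B)` — [B7] Prop. 1∕2∕7-class stability of the holomorphic tower along COMPLEX perturbations — are HYPOTHESES here (SPEC F4′), discharged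
by nobody in this file; nothing of [B7] Prop. 3∕(133)–(135) or [B11] (44)'s constant is proved.  (ℓa-C)(ℓa-H)(ℓd) DISPLAYED; (R1)∕(R2) OPEN; K0ᴬ ⟨stmt-QuantumFields-27238⟩ NOT
closed; K0ᴬ∕K1ᴬ∕K3ᴬ 0∕3; NODE O 0∕1; COUNT 8∕28 · K 1∕4 UNMOVED; finite `𝕋⁴_{L^K}` at fixed ε — NOT continuum ∕ ℝ⁴ ∕ OS; **the Yang–Mills mass gap (Clay) is NOT proved by any
of this.**  No `sorry`, `instance`, `notation`, `set_option`; standard axioms.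
-/

noncomputable section

open scoped Matrix Matrix.Norms.L2Operator InnerProductSpace ComplexConjugate Topology
open NormedSpace (exp)
open Filter Metric Set

namespace Summit.QuantumFields.YangMills.Theorems.C44IterMh

open Literature.MathematicalPhysics.QuantumFieldTheory.Balaban1983to89
open Literature.MathematicalPhysics.QuantumFieldTheory.Balaban1983to89.Node00
open BlockAveraging
open B15AveragingHolomorphic (iterMh coeField_iter_eq_iterMh differentiableAt_iterMh)
open MatrixLog (mlog mlog_one)
open ExpMeanLog (expMeanLogSU)
open T4Continuum
open B7TransferAnalyticMean (norm_sub_sub_fderiv_le_of_line hasDerivAt_line)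

variable {P : Params} {N : ℕ} [NeZero N]

/-- `G(0) = 0`: at `X = 0` the chart sits at `↑U₀`, whose holomorphic average under the guard is the unitary `↑Ū^k(U₀)` (✓`coeField_iter_eq_iterMh`), and `log 1 = 0`.
[cite: Balaban1985Variational, (44) p.285, (55) p.286; Balaban1987RG1, (0.4) p.253] -/
theorem logChart_iterMh_zero (U₀ : GaugeField P 0 (SU N)) {k : ℕ} (h : SmallBelow (fun j => blockAvg (P := P) (j := j) expMeanLogSU) k U₀) :
    logOver (coeField (Averaging.iter (fun j => blockAvg (P := P) (j := j) expMeanLogSU) k U₀)) (iterMh k (expOver U₀ 0)) = 0 := by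
  funext c
  rw [expOver_zero, ← coeField_iter_eq_iterMh k h, logOver_apply, coeField_apply,
    Unitary.mul_star_self_of_mem (Matrix.specialUnitaryGroup_le_unitaryGroup (Averaging.iter _ k U₀ c).2), mlog_one, smul_zero, Pi.zero_apply]

/-- ★ **THE FRÉCHET DERIVATIVE OF THE LOG-AVERAGED CHART AT `0`, APPLIED**: if `G` is ℂ-differentiable at `0`, then for every `X` and coarse bond `c`,
`(DG(0)X)(c) = D(Ū^k_h)(↑U₀)[X·U₀](c)·Ū^k(U₀)(c)⋆` (F1 ✓`hasDerivAt_logChart_iterMh_line` + uniqueness of the derivative along the line `t ↦ tX`).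
[cite: Balaban1985Variational, (44) p.285; Balaban1987RG1, (0.4) p.253] -/
theorem fderiv_logChart_iterMh_apply (U₀ : GaugeField P 0 (SU N)) {k : ℕ} (h : SmallBelow (fun j => blockAvg (P := P) (j := j) expMeanLogSU) k U₀)
    (hd : DifferentiableAt ℂ (fun X : PBond P 0 → Matrix (Fin N) (Fin N) ℂ =>
      logOver (coeField (Averaging.iter (fun j => blockAvg (P := P) (j := j) expMeanLogSU) k U₀)) (iterMh k (expOver U₀ X))) 0)
    (X : PBond P 0 → Matrix (Fin N) (Fin N) ℂ) (c : PBond P k) :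
    fderiv ℂ (fun X : PBond P 0 → Matrix (Fin N) (Fin N) ℂ =>
        logOver (coeField (Averaging.iter (fun j => blockAvg (P := P) (j := j) expMeanLogSU) k U₀)) (iterMh k (expOver U₀ X))) 0 X c =
      fderiv ℂ (iterMh k : (PBond P 0 → Matrix (Fin N) (Fin N) ℂ) → PBond P k → Matrix (Fin N) (Fin N) ℂ) (coeField U₀)
          (fun b => X b * (U₀ b : Matrix (Fin N) (Fin N) ℂ)) c *
        star ((Averaging.iter (fun j => blockAvg (P := P) (j := j) expMeanLogSU) k U₀ c : SU N) : Matrix (Fin N) (Fin N) ℂ) := by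
  set G := fun X : PBond P 0 → Matrix (Fin N) (Fin N) ℂ =>
    logOver (coeField (Averaging.iter (fun j => blockAvg (P := P) (j := j) expMeanLogSU) k U₀)) (iterMh k (expOver U₀ X)) with hG
  have hline : HasDerivAt (fun t : ℂ => t • X) X 0 := by
    have hl := (hasDerivAt_id (0 : ℂ)).smul_const X
    rw [one_smul] at hl
    exact hl
  have hF0 : HasFDerivAt G (fderiv ℂ G 0) ((0 : ℂ) • X) := by rw [zero_smul]; exact hd.hasFDerivAt
  have hcurve := hF0.comp_hasDerivAt (0 : ℂ) hline
  have hc : HasDerivAt (fun t : ℂ => G (t • X) c) (fderiv ℂ G 0 X c) 0 := (hasDerivAt_pi.1 hcurve) c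
  have h1 := hasDerivAt_logChart_iterMh_line U₀ h X c
  exact hc.unique h1

/-- ★ **… and on TRACELESS directions it is `L^k·Q_k(U₀)X`** (F1 ✓`fderiv_iterMh_mul_star_eq_qCplxOp`). [cite: Balaban1985BackgroundPropagators, (3.13) p.393; Balaban1985Variational, (44) p.285] -/
theorem fderiv_logChart_iterMh_apply_of_traceless (U₀ : GaugeField P 0 (SU N)) {k : ℕ} (h : SmallBelow (fun j => blockAvg (P := P) (j := j) expMeanLogSU) k U₀)
    (hd : DifferentiableAt ℂ (fun X : PBond P 0 → Matrix (Fin N) (Fin N) ℂ =>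
      logOver (coeField (Averaging.iter (fun j => blockAvg (P := P) (j := j) expMeanLogSU) k U₀)) (iterMh k (expOver U₀ X))) 0)
    {X : PBond P 0 → Matrix (Fin N) (Fin N) ℂ} (hX : ∀ b, (X b).trace = 0) :
    fderiv ℂ (fun X : PBond P 0 → Matrix (Fin N) (Fin N) ℂ =>
        logOver (coeField (Averaging.iter (fun j => blockAvg (P := P) (j := j) expMeanLogSU) k U₀)) (iterMh k (expOver U₀ X))) 0 X =
      ((P.L : ℂ) ^ k) • qCplxOp k U₀ X := by
  funext c
  rw [fderiv_logChart_iterMh_apply U₀ h hd X c, Pi.smul_apply, fderiv_iterMh_mul_star_eq_qCplxOp U₀ h hX c]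

/-- ★★★ **THE (44) REMAINDER OF THE LOG-AVERAGED `k`-FOLD CHART BY CAUCHY ESTIMATES.**  Let `G X := (1/i)·log(Ū^k_h(e^{X}U₀)·Ū^k(U₀)⋆)` (bondwise on the coarse lattice, sup norms).
IF `G` is ℂ-differentiable on the sup-ball `‖X‖ < ρ` and `‖G X‖ ≤ B` there, THEN for every TRACELESS `X` with `4‖X‖ ≤ ρ`:
`‖G X − L^k • Q_k(U₀) X‖ ≤ 8·B·‖X‖²∕ρ²` — Cauchy's inequality for the second Taylor remainder along the complex line `t ↦ tX` (lit ✓`norm_sub_sub_fderiv_le_of_line`), `G 0 = 0`,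
`DG(0) = L^k·Q_k(U₀)` on traceless `X` (F1).  [B11] (44) «`|C(A′)| ≤ C₂|A′|²`, `C₂` depends on `d, L` only» follows with `C₂ = 8B∕ρ²` once `B, ρ` are k-free (SPEC F4′);
[B12] p.253: «valid universally for all averages» with the analyticity (0.8). [cite: Balaban1985Variational, (44) p.285, (52) p.285; Balaban1987RG1, (0.8) p.253, p.254; Balaban1985Averaging, Proposition 7 p.43] -/
theorem norm_logChart_iterMh_sub_qCplxOp_le (U₀ : GaugeField P 0 (SU N)) {k : ℕ} (h : SmallBelow (fun j => blockAvg (P := P) (j := j) expMeanLogSU) k U₀)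
    {ρ B : ℝ} (hρ : 0 < ρ)
    (hdiff : DifferentiableOn ℂ (fun X : PBond P 0 → Matrix (Fin N) (Fin N) ℂ =>
      logOver (coeField (Averaging.iter (fun j => blockAvg (P := P) (j := j) expMeanLogSU) k U₀)) (iterMh k (expOver U₀ X))) (ball 0 ρ))
    (hB : ∀ X ∈ ball (0 : PBond P 0 → Matrix (Fin N) (Fin N) ℂ) ρ,
      ‖logOver (coeField (Averaging.iter (fun j => blockAvg (P := P) (j := j) expMeanLogSU) k U₀)) (iterMh k (expOver U₀ X))‖ ≤ B)
    {X : PBond P 0 → Matrix (Fin N) (Fin N) ℂ} (hX : ∀ b, (X b).trace = 0) (hXρ : 4 * ‖X‖ ≤ ρ) :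
    ‖logOver (coeField (Averaging.iter (fun j => blockAvg (P := P) (j := j) expMeanLogSU) k U₀)) (iterMh k (expOver U₀ X)) - ((P.L : ℂ) ^ k) • qCplxOp k U₀ X‖
      ≤ 8 * B * ‖X‖ ^ 2 / ρ ^ 2 := by
  set G := fun X : PBond P 0 → Matrix (Fin N) (Fin N) ℂ =>
    logOver (coeField (Averaging.iter (fun j => blockAvg (P := P) (j := j) expMeanLogSU) k U₀)) (iterMh k (expOver U₀ X)) with hG
  have h0 : (0 : PBond P 0 → Matrix (Fin N) (Fin N) ℂ) ∈ ball (0 : PBond P 0 → Matrix (Fin N) (Fin N) ℂ) ρ := mem_ball_self hρ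
  have hv : 4 * ‖X‖ ≤ ρ - ‖(0 : PBond P 0 → Matrix (Fin N) (Fin N) ℂ) - 0‖ := by rwa [sub_zero, norm_zero, sub_zero]
  have hc := norm_sub_sub_fderiv_le_of_line (Φ := G) (x₀ := 0) (r := ρ) (B := B) hdiff hB h0 hv
  have hd : DifferentiableAt ℂ G 0 := hdiff.differentiableAt (isOpen_ball.mem_nhds h0)
  have hG0 : G 0 = 0 := by rw [hG]; exact logChart_iterMh_zero U₀ h
  rw [zero_add, hG0, sub_zero, fderiv_logChart_iterMh_apply_of_traceless U₀ h hd hX, sub_zero, norm_zero, sub_zero] at hc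
  exact hc

end Summit.QuantumFields.YangMills.Theorems.C44IterMh

end
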